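import Literature.Computability.AlgebraicComplexity.RealTauConjectureDepthFour
import Literature.Computability.AlgebraicComplexity.DetInVP
import Literature.Computability.AlgebraicComplexity.TauConjecture
import Summits.ValiantsHypothesis.ValiantsHypothesis.Theorems.LacunarySymmetroidMatrixDescartesCensusDefs

/-!
# Route «KPlusLogSqLaw» (items stmt-ValiantsHypothesis-19561 `WeakLifting`, -19772 `Lifting`, Conjecture B) — the REAL census row
# lives under Koiran's real τ-conjecture: `ζ(m, K) ≤ 2^{O(√m·(log m + log K))}`, hence B / (Weak)Lifting on the fat strip

HONEST FRAMING.  Def-free helper (`--supports stmt-ValiantsHypothesis-19561`); the real-side twin of `…TropicalBShadowCeilingBridge` /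
`…TropicalBTowerLogOfNewtonTau` (tropical rows under the Newton-polygon τ-conjecture).  Nothing here asserts `KPlusLogSqLaw`,
`WeakLifting`, `Lifting`, `MatrixDescartes`, the real τ-conjecture or anything on VP ≠ VNP: every statement is an implication FROM the
open conjecture `Literature…KoiranRealTauConjecture` (Koiran 2011 / Tavenas 2014 Conj. 3.2), or unconditional algebra.

* `card_support_aeval_le_of_sparse` — a `K`-SPARSE univariate substitution multiplies the number of monomials of a polynomial of total
  degree `≤ D` by at most `K^D` (the term case `K = 1` is the tree's `card_support_aeval_le_of_isTerm`);
* `exists_sps_aeval_detPoly_sparse` — depth four (Tavenas, in-tree `DepthReduction.SLP.exists_sum_prod`, bottom degree `⌊√n⌋+1`, applied to a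
  minimal circuit of `DET_n`, `complexity_detPoly_le`) PLUS a `K`-sparse univariate substitution: `DET_n(v) = ∑_{i<k} ∏_{j<m} g_ij` with
  `k ≤ (n+2)^{C(⌊√n⌋+1)}`, `m ≤ C(⌊√n⌋+1)`, every `g_ij` with `≤ (n+2)^{C(⌊√n⌋+1)}·K^{⌊√n⌋+1}` monomials — whatever the DEGREES of the `v_ij`
  (this is why lacunary exponents cost nothing here);
* `det_pencil_eq_aeval` — the determinant of a lacunary pencil `∑_l X^{d_l} S_l` is `DET_m` at the `K`-sparse entries `∑_l S_l(i,j) X^{d_l}`;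
* `realRootLawAt_of_realTau` — `KoiranRealTauConjecture → ∃ c, ∀ m K, RealRootLawAt m K ((4·(m+2)^{c₁(⌊√m⌋+1)}·(K+1)^{⌊√m⌋+1})^c)`-shape bound,
  packaged as `realRootLawAt_fatStrip_of_realTau : KoiranRealTauConjecture → ∃ C, ∀ m K, (⌊√m⌋+1)·(⌊log₂ m⌋+⌊log₂ K⌋+3) ≤ K →
  RealRootLawAt m K (2^{C·K})` — Conjecture B (`KPlusLogSqLaw`), and with it the conclusions of `WeakLifting`/`Lifting` WHATEVER the tropical
  input, on the fat strip `K ≳ √m·log(mK)`, CONDITIONALLY on the real τ-conjecture.  (The LacunarySymmetroid thesis l.147 records only that the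
  real τ-conjecture «does NOT moot the route»; this strip implication is new to the tree.)
[folklore] depth reduction + sparse substitution; Koiran ICS 2011, Tavenas 2014 Conj. 3.2 (the conjecture, hypothesis only).
-/

set_option linter.dupNamespace false
set_option autoImplicit false

noncomputable section

namespace Summit.ValiantsHypothesis.ValiantsHypothesis.Theorems.KPlusLogSqLaw.RealTauFatStrip

open MvPolynomial
open Literature.Computability.AlgebraicComplexity
open Literature.Computability.AlgebraicComplexity.ArithCircuit
open Summit.ValiantsHypothesis.ValiantsHypothesis.Theorems.LacunarySymmetroidMatrixDescartes

/-! ## 1. Sparse univariate substitutions -/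

/-- powers of a `K`-sparse univariate polynomial are `K^e`-sparse. [folklore] -/
theorem card_support_pow_le {R : Type*} [CommSemiring R] (p : Polynomial R) {K : ℕ} (hp : p.support.card ≤ K) (e : ℕ) :
    (p ^ e).support.card ≤ K ^ e := by
  induction e with
  | zero =>
    rw [pow_zero, pow_zero]
    exact (isTerm_one (R := R)).card_support_le
  | succ e ih =>
    rw [pow_succ, pow_succ]
    exact (Polynomial.card_support_mul_le).trans (Nat.mul_le_mul ih hp)

/-- a finite sum of univariate polynomials has at most the total number of monomials. [folklore] -/
theorem card_support_sum_le {R : Type*} [Semiring R] {ι : Type*} (s : Finset ι) (f : ι → Polynomial R) :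
    (∑ i ∈ s, f i).support.card ≤ ∑ i ∈ s, (f i).support.card := by
  classical
  induction s using Finset.induction_on with
  | empty => simp
  | insert a s ha ih =>
    rw [Finset.sum_insert ha, Finset.sum_insert ha]
    exact (Finset.card_le_card Polynomial.support_add).trans ((Finset.card_union_le _ _).trans (by omega))

/-- a finite product of `K`-sparse-power factors: `∏_{x∈s} (v x)^{e x}` has at most `K^{∑ e}` monomials. [folklore] -/
theorem card_support_prod_pow_le {R : Type*} [CommSemiring R] {σ : Type*} (s : Finset σ) (v : σ → Polynomial R) (e : σ → ℕ)
    {K : ℕ} (hv : ∀ x, (v x).support.card ≤ K) :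
    (∏ x ∈ s, v x ^ e x).support.card ≤ K ^ (∑ x ∈ s, e x) := by
  classical
  induction s using Finset.induction_on with
  | empty =>
    rw [Finset.prod_empty, Finset.sum_empty, pow_zero]
    exact (isTerm_one (R := R)).card_support_le
  | insert a s ha ih =>
    rw [Finset.prod_insert ha, Finset.sum_insert ha, pow_add]
    exact (Polynomial.card_support_mul_le).trans (Nat.mul_le_mul (card_support_pow_le _ (hv a) _) ih)

/-- **Sparse substitutions multiply sparsity by at most `K^{deg}`**: if every `v x` has at most `K ≥ 1` monomials and `p` has total
degree `≤ D`, then `aeval v p` has at most `#supp p · K^D` monomials. [folklore] -/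
theorem card_support_aeval_le_of_sparse {R : Type*} [CommSemiring R] {σ : Type*} {v : σ → Polynomial R} {K : ℕ} (hK : 1 ≤ K)
    (hv : ∀ x, (v x).support.card ≤ K) (p : MvPolynomial σ R) {D : ℕ} (hp : p.totalDegree ≤ D) :
    (MvPolynomial.aeval v p).support.card ≤ p.support.card * K ^ D := by
  classical
  have hmono : ∀ m ∈ p.support, (MvPolynomial.aeval v (MvPolynomial.monomial m (p.coeff m))).support.card ≤ K ^ D := by
    intro m hm
    rw [MvPolynomial.aeval_monomial, Finsupp.prod]
    have hdeg : (∑ x ∈ m.support, m x) ≤ D := by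
      have := le_totalDegree hm
      rw [Finsupp.sum] at this
      exact this.trans hp
    calc ((algebraMap R (Polynomial R)) (p.coeff m) * ∏ x ∈ m.support, v x ^ m x).support.card
        ≤ ((algebraMap R (Polynomial R)) (p.coeff m)).support.card * (∏ x ∈ m.support, v x ^ m x).support.card :=
          Polynomial.card_support_mul_le
      _ ≤ 1 * K ^ (∑ x ∈ m.support, m x) := by
          refine Nat.mul_le_mul ?_ (card_support_prod_pow_le _ v m hv)
          rw [Polynomial.algebraMap_eq]
          exact (isTerm_C (p.coeff m)).card_support_le
      _ ≤ K ^ D := by rw [one_mul]; exact Nat.pow_le_pow_right hK hdeg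
  conv_lhs => rw [p.as_sum]
  rw [map_sum]
  calc (∑ m ∈ p.support, MvPolynomial.aeval v (MvPolynomial.monomial m (p.coeff m))).support.card
      ≤ ∑ m ∈ p.support, (MvPolynomial.aeval v (MvPolynomial.monomial m (p.coeff m))).support.card := card_support_sum_le _ _
    _ ≤ ∑ _m ∈ p.support, K ^ D := Finset.sum_le_sum hmono
    _ = p.support.card * K ^ D := by rw [Finset.sum_const, smul_eq_mul]

/-! ## 2. Depth four plus a sparse univariate substitution for the determinant -/

/-- **Depth four plus `K`-sparse substitution for `DET_n`** (real coefficients): `DET_n(v) = ∑_{i<k} ∏_{j<m} g_ij` with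
`k ≤ (n+2)^{C(⌊√n⌋+1)}`, `m ≤ C(⌊√n⌋+1)`, every `g_ij` with at most `(n+2)^{C(⌊√n⌋+1)}·K^{⌊√n⌋+1}` monomials, for every substitution
`v` of the `n²` variables by univariate polynomials with `≤ K` monomials each (`K ≥ 1`), of ARBITRARY degrees. [folklore] -/
theorem exists_sps_aeval_detPoly_sparse :
    ∃ C : ℕ, ∀ (n K : ℕ) (v : Fin n × Fin n → Polynomial ℝ), 1 ≤ K → (∀ x, (v x).support.card ≤ K) →
      ∃ (k m t : ℕ) (g : Fin k → Fin m → Polynomial ℝ),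
        k ≤ (n + 2) ^ (C * (Nat.sqrt n + 1)) ∧
        m ≤ C * (Nat.sqrt n + 1) ∧
        t ≤ (n + 2) ^ (C * (Nat.sqrt n + 1)) * K ^ (Nat.sqrt n + 1) ∧
        (∀ i j, (g i j).support.card ≤ t) ∧
        (∑ i, ∏ j, g i j) = MvPolynomial.aeval v (detPoly (Fin n) ℝ) := by
  classical
  refine ⟨prop321Const 12, fun n K v hK hv => ?_⟩
  have hB2 : 2 ≤ n + 2 := by omega
  set D : ℕ := Nat.sqrt n + 1 with hD
  have hD1 : 1 ≤ D := Nat.succ_pos _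
  obtain ⟨s, hs⟩ : ∃ s : ℕ, complexity (detPoly (Fin n) ℝ) = s := ⟨_, rfl⟩
  have h8 : 8 ≤ (n + 2) ^ 3 := by
    calc 8 = 2 ^ 3 := by norm_num
      _ ≤ (n + 2) ^ 3 := Nat.pow_le_pow_left hB2 3
  have hsle : s ≤ (n + 2) ^ 12 := by
    calc s = complexity (detPoly (Fin n) ℝ) := hs.symm
      _ ≤ 8 * (n + 1) ^ 7 := complexity_detPoly_le ℝ n
      _ ≤ (n + 2) ^ 3 * (n + 2) ^ 7 :=
          Nat.mul_le_mul h8 (Nat.pow_le_pow_left (by omega) 7)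
      _ = (n + 2) ^ 10 := by rw [← pow_add]
      _ ≤ (n + 2) ^ 12 := Nat.pow_le_pow_right (by omega) (by omega)
  have hsqrt_le : Nat.sqrt n ≤ n := Nat.sqrt_le_self n
  have hδ1 : n + 1 ≤ (n + 2) ^ 12 := by
    have : n + 1 ≤ (n + 2) ^ 1 := by rw [pow_one]; omega
    exact this.trans (Nat.pow_le_pow_right (by omega) (by omega))
  have hu1 : D + 1 ≤ (n + 2) ^ 12 := by
    have : D + 1 ≤ (n + 2) ^ 1 := by rw [pow_one]; omega
    exact this.trans (Nat.pow_le_pow_right (by omega) (by omega))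
  have hδu : n * n + D ≤ (n + 2) ^ 12 := by
    have : n * n + D ≤ (n + 2) ^ 2 := by rw [pow_two]; nlinarith
    exact this.trans (Nat.pow_le_pow_right (by omega) (by omega))
  have huD : D ≤ 2 * D := by omega
  have hRle : 8 * n / (D + 1) ≤ 16 * D := (rounds_le n).trans (by omega)
  -- sparsity after the substitution
  have hsparse : ∀ p : MvPolynomial (Fin n × Fin n) ℝ, p.totalDegree ≤ D →
      (MvPolynomial.aeval v p).support.card ≤ (n + 2) ^ (prop321Const 12 * D) * K ^ D := by
    intro p hp
    calc (MvPolynomial.aeval v p).support.card ≤ p.support.card * K ^ D :=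
          card_support_aeval_le_of_sparse hK hv p hp
      _ ≤ ((D + 1) * (Fintype.card (Fin n × Fin n) + D) ^ D) * K ^ D :=
          Nat.mul_le_mul_right _
            (DepthReduction.card_le_of_degree_le _ hD1 fun m hm => (le_totalDegree hm).trans hp)
      _ = ((D + 1) * (n * n + D) ^ D) * K ^ D := by rw [Fintype.card_prod, Fintype.card_fin]
      _ ≤ (n + 2) ^ (prop321Const 12 * D) * K ^ D := Nat.mul_le_mul_right _ (prop321_tBound hB2 hD1 hu1 hδu huD)
  obtain ⟨P, hP1, hP2, hP3⟩ := exists_computes_size_eq_complexity (detPoly (Fin n) ℝ)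
  obtain ⟨S, hSlen, hcases⟩ := DepthReduction.exists_slp P hP1
  rw [show P.eval = detPoly (Fin n) ℝ from hP2] at hcases
  rw [hs] at hP3
  have ht1 : K ≤ (n + 2) ^ (prop321Const 12 * D) * K ^ D := by
    have h1 : 1 ≤ (n + 2) ^ (prop321Const 12 * D) := Nat.one_le_pow _ _ (by omega)
    have h2 : K ≤ K ^ D := by
      calc K = K ^ 1 := (pow_one K).symm
        _ ≤ K ^ D := Nat.pow_le_pow_right hK hD1
    calc K ≤ 1 * K ^ D := by rw [one_mul]; exact h2
      _ ≤ (n + 2) ^ (prop321Const 12 * D) * K ^ D := Nat.mul_le_mul_right _ h1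
  rcases hcases with ⟨i, hi, hval⟩ | htriv
  · have hdegh : (S.val i).totalDegree ≤ n := by
      rw [← hval]
      simpa using (detPoly_isHomogeneous (n := Fin n) (k := ℝ)).totalDegree_le
    obtain ⟨L, hLsum, hLlen, hLT⟩ := S.exists_sum_prod n (t := D) hD1 hi hdegh
    rw [hSlen, hP3] at hLlen
    refine ⟨L.length, 1 + 4 * (8 * n / (D + 1)), (n + 2) ^ (prop321Const 12 * D) * K ^ D,
      fun i j => MvPolynomial.aeval v ((L[i.val]).getD j.val 1),
      hLlen.trans (prop321_kBound hB2 hD1 hδ1 hsle hRle), prop321_mBound hD1 hRle, le_rfl, ?_, ?_⟩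
    · intro i j
      apply hsparse
      rcases DepthReduction.getD_one_mem_or (L[i.val]) j.val with hmem | hone
      · exact (hLT _ (List.getElem_mem _)).2 _ hmem
      · rw [hone, totalDegree_one]; exact Nat.zero_le _
    · rw [hval, ← hLsum]
      have hprod : ∀ i : Fin L.length,
          ∏ j : Fin (1 + 4 * (8 * n / (D + 1))), MvPolynomial.aeval v ((L[i.val]).getD j.val 1) =
            MvPolynomial.aeval v (L[i.val]).prod := fun i => by
        rw [← map_prod, DepthReduction.prod_getD_one _ _ (hLT _ (List.getElem_mem _)).1]
      simp only [hprod]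
      rw [map_list_sum, List.map_map]
      exact Fin.sum_univ_fun_getElem L (fun l => MvPolynomial.aeval v l.prod)
  · -- degenerate case: `DET_n` is a variable or a constant
    have hcard : (MvPolynomial.aeval v (detPoly (Fin n) ℝ)).support.card ≤ (n + 2) ^ (prop321Const 12 * D) * K ^ D := by
      rcases htriv with ⟨j, hj⟩ | ⟨c, hc⟩
      · rw [hj, MvPolynomial.aeval_X]; exact (hv j).trans ht1
      · rw [hc, MvPolynomial.aeval_C, Polynomial.algebraMap_eq]
        exact (isTerm_C c).card_support_le.trans ((hK.trans ht1))
    have h1 : 1 ≤ (n + 2) ^ (prop321Const 12 * D) := Nat.one_le_pow _ _ (by omega)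
    refine ⟨1, 1, (n + 2) ^ (prop321Const 12 * D) * K ^ D, fun _ _ => MvPolynomial.aeval v (detPoly (Fin n) ℝ), h1,
      one_le_prop321Const_mul hD1, le_rfl, fun _ _ => hcard, ?_⟩
    simp

/-! ## 3. Lacunary pencils are sparse substitutions of `DET_m` -/

/-- the `(i, j)` entry polynomial of the pencil `∑_l X^{d_l} S_l`. [folklore] -/
theorem pencil_apply {m K : ℕ} (d : Fin K → ℕ) (S : Fin K → Matrix (Fin m) (Fin m) ℝ) (i j : Fin m) :
    (∑ l, ((Polynomial.X : Polynomial ℝ) ^ d l) • (S l).map Polynomial.C) i j =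
      ∑ l, Polynomial.C (S l i j) * Polynomial.X ^ d l := by
  rw [Matrix.sum_apply]
  refine Finset.sum_congr rfl fun l _ => ?_
  rw [Matrix.smul_apply, Matrix.map_apply, smul_eq_mul, mul_comm]

/-- the entry polynomials are `K`-sparse. [folklore] -/
theorem card_support_entry_le {m K : ℕ} (d : Fin K → ℕ) (S : Fin K → Matrix (Fin m) (Fin m) ℝ) (i j : Fin m) :
    (∑ l, Polynomial.C (S l i j) * Polynomial.X ^ d l).support.card ≤ K := by
  have h1 : ∀ l ∈ (Finset.univ : Finset (Fin K)),
      (Polynomial.C (S l i j) * Polynomial.X ^ d l).support.card ≤ (fun _ => (1 : ℕ)) l :=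
    fun l _ => (isTerm_C (S l i j)).mul (isTerm_X_pow (d l)) |>.card_support_le
  have h2 := card_support_sum_le (Finset.univ : Finset (Fin K)) (fun l => Polynomial.C (S l i j) * Polynomial.X ^ d l)
  have h3 := Finset.sum_le_sum h1
  simp only [Finset.sum_const, Finset.card_univ, Fintype.card_fin, smul_eq_mul, mul_one] at h3
  exact h2.trans h3

/-- **The determinant of a lacunary pencil is `DET_m` at its (sparse) entries.** [folklore] -/
theorem det_pencil_eq_aeval {m K : ℕ} (d : Fin K → ℕ) (S : Fin K → Matrix (Fin m) (Fin m) ℝ) :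
    Matrix.det (∑ l, ((Polynomial.X : Polynomial ℝ) ^ d l) • (S l).map Polynomial.C) =
      MvPolynomial.aeval (fun ij : Fin m × Fin m => ∑ l, Polynomial.C (S l ij.1 ij.2) * Polynomial.X ^ d l)
        (detPoly (Fin m) ℝ) := by
  rw [detPoly, AlgHom.map_det, AlgHom.mapMatrix_apply]
  congr 1
  ext i j : 1
  rw [pencil_apply, Matrix.map_apply, Matrix.mvPolynomialX_apply, MvPolynomial.aeval_X]

/-! ## 4. The real census row under the real τ-conjecture -/

/-- **Real rows under Koiran's real τ-conjecture (raw form).**  With `c` the conjecture's exponent and `C` the depth-four constant: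
`ζ(m, K) ≤ (4·(m+2)^{C(⌊√m⌋+1)}·K^{⌊√m⌋+1})^c` for all `m` and `K ≥ 1`. [folklore] -/
theorem realRootLawAt_of_realTau_raw (hτ : KoiranRealTauConjecture) :
    ∃ c C : ℕ, ∀ m K : ℕ, 1 ≤ K →
      RealRootLawAt m K ((4 * ((m + 2) ^ (C * (Nat.sqrt m + 1)) * K ^ (Nat.sqrt m + 1))) ^ c) := by
  obtain ⟨c, hc⟩ := hτ
  obtain ⟨C, hC⟩ := exists_sps_aeval_detPoly_sparse
  refine ⟨c, C, fun m K hK => ?_⟩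
  intro d S _hS
  set v : Fin m × Fin m → Polynomial ℝ := fun ij => ∑ l, Polynomial.C (S l ij.1 ij.2) * Polynomial.X ^ d l with hv
  have hvK : ∀ x, (v x).support.card ≤ K := fun x => card_support_entry_le d S x.1 x.2
  obtain ⟨k, m', t, g, hk, hm', ht, hg, hsum⟩ := hC m K v hK hvK
  rw [det_pencil_eq_aeval, ← hv, ← hsum]
  by_cases hzero : (∑ i, ∏ j, g i j) = 0
  · rw [hzero, Polynomial.roots_zero]; simp
  refine (hc k m' t g hg hzero).trans (Nat.pow_le_pow_left ?_ c)
  -- `k + m' + t + 2 ≤ 4 · (m+2)^{C D} · K^D`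
  set A : ℕ := (m + 2) ^ (C * (Nat.sqrt m + 1)) * K ^ (Nat.sqrt m + 1) with hA
  have hA1 : (m + 2) ^ (C * (Nat.sqrt m + 1)) ≤ A := by
    rw [hA]; exact Nat.le_mul_of_pos_right _ (Nat.pow_pos hK)
  have hpow1 : 1 ≤ (m + 2) ^ (C * (Nat.sqrt m + 1)) := Nat.one_le_pow _ _ (by omega)
  have hkA : k ≤ A := hk.trans hA1
  have htA : t ≤ A := by rw [hA]; exact ht
  have hmA : m' + 1 ≤ A := by
    have hlt : C * (Nat.sqrt m + 1) < (m + 2) ^ (C * (Nat.sqrt m + 1)) := Nat.lt_pow_self (by omega)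
    have : m' + 1 ≤ (m + 2) ^ (C * (Nat.sqrt m + 1)) := by omega
    exact this.trans hA1
  have hA1' : 1 ≤ A := hpow1.trans hA1
  omega

/-- **THE FAT STRIP OF CONJECTURE B UNDER THE REAL τ-CONJECTURE**: `KoiranRealTauConjecture → ∃ C, ∀ m K,
(⌊√m⌋+1)·(⌊log₂ m⌋+⌊log₂ K⌋+3) ≤ K → RealRootLawAt m K (2^{C·K})` — so on the strip `K ≳ √m·log(mK)` Conjecture B (`KPlusLogSqLaw`,
bound `2^{C(K+log² m)}`) and the conclusions of `WeakLifting` / `Lifting` (bounds `2^{C(K+log²m)}(n+1)`, `2^{CK}(n+1)`) hold whatever the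
tropical input, conditionally on the real τ-conjecture. [folklore] -/
theorem realRootLawAt_fatStrip_of_realTau (hτ : KoiranRealTauConjecture) :
    ∃ C : ℕ, ∀ m K : ℕ, (Nat.sqrt m + 1) * (Nat.log 2 m + Nat.log 2 K + 3) ≤ K → RealRootLawAt m K (2 ^ (C * K)) := by
  obtain ⟨c, C, h⟩ := realRootLawAt_of_realTau_raw hτ
  refine ⟨c * (C + 2), fun m K hK => ?_⟩
  have hK1 : 1 ≤ K := le_trans (by nlinarith [Nat.zero_le (Nat.sqrt m), Nat.zero_le (Nat.log 2 m + Nat.log 2 K)]) hK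
  intro d S hS
  refine (h m K hK1 d S hS).trans ?_
  set D := Nat.sqrt m + 1 with hD
  set L := Nat.log 2 m with hL
  set L' := Nat.log 2 K with hL'
  -- bits: `m + 2 ≤ 2^{L+2}`, `K ≤ 2^{L'+1}`
  have hm2 : m + 2 ≤ 2 ^ (L + 2) := by
    have hlt := Nat.lt_pow_succ_log_self (b := 2) (by norm_num) m
    have h2 : 2 ≤ 2 ^ (L + 1) := by
      calc 2 = 2 ^ 1 := by norm_num
        _ ≤ 2 ^ (L + 1) := Nat.pow_le_pow_right (by norm_num) (by omega)
    calc m + 2 ≤ 2 ^ (L + 1) + 2 ^ (L + 1) := by rw [hL]; omega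
      _ = 2 ^ (L + 2) := by ring
  have hK2 : K ≤ 2 ^ (L' + 1) := by rw [hL']; exact (Nat.lt_pow_succ_log_self (by norm_num) K).le
  have hbase : 4 * ((m + 2) ^ (C * D) * K ^ D) ≤ 2 ^ (2 + (L + 2) * (C * D) + (L' + 1) * D) := by
    calc 4 * ((m + 2) ^ (C * D) * K ^ D) ≤ 4 * ((2 ^ (L + 2)) ^ (C * D) * (2 ^ (L' + 1)) ^ D) := by gcongr
      _ = 2 ^ (2 + (L + 2) * (C * D) + (L' + 1) * D) := by
          rw [← pow_mul, ← pow_mul, pow_add, pow_add]; ring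
  have hexp : 2 + (L + 2) * (C * D) + (L' + 1) * D ≤ (C + 2) * K := by
    have h1 : D * (L + L' + 3) ≤ K := hK
    have h2 : (C + 2) * (D * (L + L' + 3)) ≤ (C + 2) * K := Nat.mul_le_mul_left _ h1
    have hD1 : 1 ≤ D := by rw [hD]; omega
    have e1 : (C + 2) * (D * (L + L' + 3)) =
        C * D * L + C * D * L' + 3 * (C * D) + 2 * (D * L) + 2 * (D * L') + 6 * D := by ring
    have e2 : (L + 2) * (C * D) = C * D * L + 2 * (C * D) := by ring
    have e3 : (L' + 1) * D = D * L' + D := by ring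
    omega
  calc (4 * ((m + 2) ^ (C * D) * K ^ D)) ^ c ≤ (2 ^ (2 + (L + 2) * (C * D) + (L' + 1) * D)) ^ c := Nat.pow_le_pow_left hbase c
    _ ≤ (2 ^ ((C + 2) * K)) ^ c := Nat.pow_le_pow_left (Nat.pow_le_pow_right (by norm_num) hexp) c
    _ = 2 ^ (c * (C + 2) * K) := by rw [← pow_mul]; ring_nf

/-- **Conjecture B on the fat strip under the real τ-conjecture**, in the census currency `2^{C(K + ⌊log₂ m⌋²)}`. [folklore] -/
theorem kPlusLogSq_fatStrip_of_realTau (hτ : KoiranRealTauConjecture) :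
    ∃ C : ℕ, ∀ m K : ℕ, (Nat.sqrt m + 1) * (Nat.log 2 m + Nat.log 2 K + 3) ≤ K →
      RealRootLawAt m K (2 ^ (C * (K + Nat.log 2 m ^ 2))) := by
  obtain ⟨C, hC⟩ := realRootLawAt_fatStrip_of_realTau hτ
  refine ⟨C, fun m K hK d S hS => (hC m K hK d S hS).trans ?_⟩
  exact Nat.pow_le_pow_right (by norm_num) (Nat.mul_le_mul_left _ (by omega))

end Summit.ValiantsHypothesis.ValiantsHypothesis.Theorems.KPlusLogSqLaw.RealTauFatStrip

end
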